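/-
Copyright (c) 2026 the pub-hodgecm-mathlib formalisation cell (harness21).  Prover seat hodgecm-mathlib-F0P2-p01 (g15): road «S3-ram» (LEAD F0P3a-plan (g12∕g13); architect
A-p16 (g32); junction pen F0P3a-p01 (g17), J-PACK v2 assembly lemma L2 «orientation of rows»; owner F0P3a-p06 (g15)); 2026-09-02.
-/
import Literature.NumberTheory.Automorphic.UnitaryLatticeTreeRegionUpClosedRamified        -- ★ p847635 ED. 2 (F0P3-p04 (g14)): `exists_parent_grandparent_lev_of_neg`
import Literature.NumberTheory.Automorphic.UnitaryLatticeTreeSeparableStableRoot          -- ★ (F0P3a-p02): `eq_stdLattice_of_isSelfDualLattice_of_levelFixed_diagonal`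
import Literature.NumberTheory.Automorphic.UnitaryLatticeTreeAlternationFormCongr         -- ★ `isSelfDualLattice_smul_formCongr_iff`
import Literature.NumberTheory.Automorphic.UnitaryLatticeTreeStabilizer                   -- ★ `mapGL_stdLattice_eq_iff`
import Literature.NumberTheory.Automorphic.UnitaryLatticeTreeFixedGrandchildrenCountRamified  -- ★ G3⁺ p847297: `latticeGraphIso_eq_iff_mapGL_eq`, transitivity re-exports
import HarnessLib

/-!
# The lattice graph of a hermitian space — THE JUNCTION'S L2 «ORIENTATION OF ROWS» (tame-ramified place, equilateral eigen-data): every non-root fixed self-dual vertex has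
# depth `< N` and an inward orientation (Bruhat–Tits 1972 §10; Tits 1979 §3.5; Kottwitz 1986 §3; Serre, *Trees* I.2.3, II.1.1)

Topic `NumberTheory/Automorphic`; namespace `Literature.NumberTheory.Automorphic.UnitaryLatticeTree`.  THEOREMS ONLY (no definition, no instance, no notation, no named fact,
no `sorry`); kernel lane `--supports stmt-HodgeConjecture-24833`.  Cell `pub/hodgecm-mathlib` (D-0151), crux H413; road «S3-ram» (Literature seeding, count-neutral), organ
A′ (ii) of the P-1-ram skeleton; junction J-PACK v2 (F0P3a-p01 (g17)), assembly lemma **L2 `orientation_of_rows`** (skeleton v7 326c2913 :493, binder order verbatim; allotted to this seat by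
A-p16 (g32)).  J₀-MODEL, token currency; the abstract depth label `dep` is characterised by `hdep` exactly as in the skeleton.

THE STATEMENT (`dep_lt_and_exists_orientation` = socket `orientation_of_rows` of skeleton v7 326c2913 :493 VERBATIM — binder order incl. `(hnorm) [ValuativeRel K]
[Valued.v.Compatible]` after `hγ0`; unused binders `_`-prefixed): for the junction's eigen-data (`γ = A·diag(s)·A⁻¹ ∈ K₀`, `A` an integral frame of `diag d = (−det diag d)•ᵗσ(A)J₀A`, `s 1 = 1`,
`|s 0 − 1| = |s 2 − 1| = |s 0 − s 2| = |ϖ|^N`, `N ≥ 3`) and labels `dep` with `e ≤ dep w ↔ e ≤ B ∧ LEV[w](ϖ^e)` (`B = N`): every fixed self-dual `v ≠ r₀` has **`dep v < N`**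
and **an inward neighbour `p` and a far vertex `g ≠ v` through `p` with `LEV[g](ϖ^(dep v))`**.

THE PROOF.  (1) `dep v < N` ⟸ **`eq_root_of_isSelfDualLattice_of_lev_pow`**: a fixed self-dual vertex with `LEV[v](ϖ^N)` IS the root — in the eigenframe `M := A⁻¹·v` is self-dual
for `diag d` (★ `isSelfDualLattice_smul_formCongr_iff`), fixed by `T = diag(s) = 1 + ϖ^N·diag(s′)` with `diag(s′)` integral and residually SEPARABLE (equilateral!), and
`(T − 1)M ⊆ ϖ^N M` (`mapGL_map_conj_le_scaleLattice`: LEV transports along frames); ★ `eq_stdLattice_of_isSelfDualLattice_of_levelFixed_diagonal` gives `M = L₀`, so `v = A·L₀ = L₀`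
(★ `mapGL_stdLattice_eq_iff`, `A` integral both ways).  (2) The `∃`-clause is ★ `exists_parent_grandparent_lev_of_neg` (F0P3-p04 (g14)) at `e := dep v` (`|s i − 1| ≤ |ϖ|^N ≤
|ϖ|^(dep v)` from `dep v ≤ B = N`).  No row and no induction is needed on this route (the rows enter L3).

* `mapGL_map_conj_le_scaleLattice` (LEV transports along a frame change), `eq_root_of_isSelfDualLattice_of_lev_pow` (the equilateral root is the only fixed self-dual vertex of
  level `ϖ^N`), **`dep_lt_and_exists_orientation`** (L2).

HONEST LABEL: HC_CM is proved only modulo the 2 remaining named inputs (hLiu418 24832, h413 24833) until rung 0 closes; nothing printed is asserted here (elementary lattice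
bookkeeping over a valuation ring); «S3-ram» has no books consequence.

## References
* [BruhatTits1972] F. Bruhat, J. Tits, *Groupes réductifs sur un corps local I*, Publ. Math. IHÉS 41 (1972), §10 (lattice models; apartments and fixed points).
* [Tits1979] J. Tits, *Reductive groups over local fields*, PSPM 33.1 (1979), §3.5 (congruence filtration).
* [Kottwitz1986] R. E. Kottwitz, *Base change for unit elements of Hecke algebras*, Compositio Math. 60 (1986), §3 (counting fixed lattices shell by shell).
* [Serre1980Trees] J.-P. Serre, *Trees* (1980), I.2.3 (rooted trees), II.1.1 (the tree of lattices).
-/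

set_option autoImplicit false

noncomputable section

open scoped Valued WithZero Matrix MatrixGroups

namespace Literature.NumberTheory.Automorphic.UnitaryLatticeTree

open Literature.NumberTheory.Automorphic Literature.NumberTheory.Automorphic.HermitianLattice

variable {K : Type*} [Field K] [Valued K ℤᵐ⁰] {σ : K →+* K} {ϖ : K}

/-- **LEV transports along a frame change**: `X·M ⊆ c·M ⇒ (P X P⁻¹)·(P·M) ⊆ c·(P·M)`. [cite: Serre1980Trees, II.1.1] -/
theorem mapGL_map_conj_le_scaleLattice {N : ℕ} (P : GL (Fin N) K) (X : Matrix (Fin N) (Fin N) K) (c : K) {M : Submodule 𝒪[K] (Fin N → K)}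
    (h : M.map ((Matrix.toLin' X).restrictScalars 𝒪[K]) ≤ scaleLattice c M) :
    (mapGL P M).map ((Matrix.toLin' ((P : Matrix (Fin N) (Fin N) K) * X * ((P⁻¹ : GL (Fin N) K) : Matrix (Fin N) (Fin N) K))).restrictScalars 𝒪[K]) ≤
      scaleLattice c (mapGL P M) := by
  have hPP : ((P⁻¹ : GL (Fin N) K) : Matrix (Fin N) (Fin N) K) * (P : Matrix (Fin N) (Fin N) K) = 1 := by rw [← Units.val_mul, inv_mul_cancel, Units.val_one]
  have hcomp : ((Matrix.toLin' ((P : Matrix (Fin N) (Fin N) K) * X * ((P⁻¹ : GL (Fin N) K) : Matrix (Fin N) (Fin N) K))).restrictScalars 𝒪[K]).comp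
        ((Matrix.toLin' (P : Matrix (Fin N) (Fin N) K)).restrictScalars 𝒪[K]) =
      ((Matrix.toLin' (P : Matrix (Fin N) (Fin N) K)).restrictScalars 𝒪[K]).comp ((Matrix.toLin' X).restrictScalars 𝒪[K]) := by
    apply LinearMap.ext
    intro x
    simp only [LinearMap.comp_apply, LinearMap.restrictScalars_apply, Matrix.toLin'_apply, Matrix.mulVec_mulVec]
    rw [Matrix.mul_assoc, Matrix.mul_assoc, hPP, Matrix.mul_one]
  rw [mapGL, ← Submodule.map_comp, hcomp, Submodule.map_comp]
  exact (Submodule.map_mono h).trans (le_of_eq (mapGL_scaleLattice P c M))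

/-- **THE EQUILATERAL ROOT IS THE ONLY FIXED SELF-DUAL VERTEX OF LEVEL `ϖ^N`**: for `γ = A·diag(s)·A⁻¹` with `A, A⁻¹` integral, `diag d = (−det diag d)•ᵗσ(A)J₀A` (unit `d`),
`s 1 = 1`, `|s 0 − 1| = |s 2 − 1| = |s 0 − s 2| = |ϖ|^N`, `N ≥ 1`: a self-dual vertex `v` with `γ·v = v` and `LEV[v](ϖ^N)` is `r₀` (★ `eq_stdLattice_of_isSelfDualLattice_of_levelFixed_diagonal`
in the eigenframe). [cite: BruhatTits1972, §10] [cite: Kottwitz1986, §3] [cite: Serre1980Trees, II.1.1] -/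
theorem eq_root_of_isSelfDualLattice_of_lev_pow (hvσ : ∀ a, Valued.v (σ a) = Valued.v a) (hϖ : Valued.v ϖ = WithZero.exp (-1 : ℤ))
    {γ : unitaryGroupOfForm σ ((StdForm.antidiagonal 3).over K)}
    (d : Fin 3 → K) (hd : ∀ i, Valued.v (d i) = 1)
    (A : GL (Fin 3) K) (hA : IsIntMatrix (A : Matrix (Fin 3) (Fin 3) K)) (hA' : IsIntMatrix ((A⁻¹ : GL (Fin 3) K) : Matrix (Fin 3) (Fin 3) K))
    (hdA : Matrix.diagonal d = (-(Matrix.diagonal d).det) • formCongr σ A ((StdForm.antidiagonal 3).over K))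
    (s : Fin 3 → K) (hs1 : s 1 = 1)
    (hγA : ((γ : GL (Fin 3) K) : Matrix (Fin 3) (Fin 3) K) = (A : Matrix (Fin 3) (Fin 3) K) * Matrix.diagonal s * ((A⁻¹ : GL (Fin 3) K) : Matrix (Fin 3) (Fin 3) K))
    {N : ℕ} (hN1 : 1 ≤ N) (hs0 : Valued.v (s 0 - 1) = Valued.v ϖ ^ N) (hs2 : Valued.v (s 2 - 1) = Valued.v ϖ ^ N) (hs02 : Valued.v (s 0 - s 2) = Valued.v ϖ ^ N)
    {v : {M : Submodule 𝒪[K] (Fin 3 → K) // IsVertex σ ϖ ((StdForm.antidiagonal 3).over K) M}} (hv : IsSelfDualLattice σ ϖ ((StdForm.antidiagonal 3).over K) v.1)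
    (hfix : latticeGraphIso σ ϖ ((StdForm.antidiagonal 3).over K) γ v = v)
    (hlev : v.1.map ((Matrix.toLin' (((γ : GL (Fin 3) K) : Matrix (Fin 3) (Fin 3) K) - 1)).restrictScalars 𝒪[K]) ≤ scaleLattice (ϖ ^ N) v.1) :
    v = ⟨stdLattice K 3, 0, isSelfDualLattice_stdLattice_three_of_v hϖ⟩ := by
  have hϖ0 : ϖ ≠ 0 := fun h0 => by rw [h0, map_zero] at hϖ; exact WithZero.coe_ne_zero hϖ.symm
  have hvϖ0 : Valued.v ϖ ≠ 0 := (Valuation.ne_zero_iff _).2 hϖ0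
  have hϖ1 : Valued.v ϖ ≤ 1 := by rw [hϖ, ← WithZero.exp_zero]; exact WithZero.exp_le_exp.2 (by norm_num)
  have hϖlt : Valued.v ϖ < 1 := by rw [hϖ, ← WithZero.exp_zero]; exact WithZero.exp_lt_exp.2 (by norm_num)
  have hc0 : ϖ ^ N ≠ 0 := pow_ne_zero _ hϖ0
  have hvc : Valued.v (ϖ ^ N) = Valued.v ϖ ^ N := map_pow _ _ _
  have hc1 : Valued.v (ϖ ^ N) < 1 := by rw [hvc]; exact pow_lt_one₀ zero_le hϖlt (by omega)
  have hvc0 : Valued.v (ϖ ^ N) ≠ 0 := (Valuation.ne_zero_iff _).2 hc0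
  -- the eigenvalue depths: `|s i − 1| ≤ |ϖ|^N`, `|s i − s j| = |ϖ|^N` (`i ≠ j`)
  have hs1' : Valued.v (s 1 - 1) ≤ Valued.v ϖ ^ N := by rw [hs1, sub_self, map_zero]; exact zero_le
  have hsi : ∀ i, Valued.v (s i - 1) ≤ Valued.v (ϖ ^ N) := by
    intro i; rw [hvc]
    fin_cases i <;> simp only [Fin.zero_eta, Fin.mk_one, Fin.reduceFinMk]
    exacts [hs0.le, hs1', hs2.le]
  have h01 : Valued.v (s 0 - s 1) = Valued.v ϖ ^ N := by rw [hs1]; exact hs0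
  have h21 : Valued.v (s 2 - s 1) = Valued.v ϖ ^ N := by rw [hs1]; exact hs2
  have h10 : Valued.v (s 1 - s 0) = Valued.v ϖ ^ N := by rw [Valuation.map_sub_swap]; exact h01
  have h12 : Valued.v (s 1 - s 2) = Valued.v ϖ ^ N := by rw [Valuation.map_sub_swap]; exact h21
  have h20 : Valued.v (s 2 - s 0) = Valued.v ϖ ^ N := by rw [Valuation.map_sub_swap]; exact hs02
  have hsij : ∀ i j : Fin 3, i ≠ j → Valued.v (s i - s j) = Valued.v (ϖ ^ N) := by
    intro i j hij; rw [hvc]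
    fin_cases i <;> fin_cases j <;> simp only [Fin.zero_eta, Fin.mk_one, Fin.reduceFinMk, ne_eq, not_true_eq_false] at hij ⊢
    exacts [h01, hs02, h10, h12, h20, h21]
  -- the normalised eigenvalues `s′ i = (s i − 1)/ϖ^N`: integral and residually separable
  set s' : Fin 3 → K := fun i => (s i - 1) / ϖ ^ N with hs'def
  have hs' : ∀ l, Valued.v (s' l) ≤ 1 := fun l => by
    rw [hs'def]; dsimp only; rw [map_div₀]; exact (div_le_one₀ (zero_lt_iff.2 hvc0)).2 (hsi l)
  have hsep : ∀ i j, i ≠ j → Valued.v (s' i - s' j) = 1 := fun i j hij => by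
    rw [hs'def]; dsimp only
    rw [div_sub_div_same, sub_sub_sub_cancel_right, map_div₀, hsij i j hij, div_self hvc0]
  -- the eigenframe element `T = A⁻¹ γ A = diag(s) = 1 + ϖ^N • diag(s′)`
  set T : GL (Fin 3) K := A⁻¹ * (γ : GL (Fin 3) K) * A with hTdef
  have hT : (T : Matrix (Fin 3) (Fin 3) K) = Matrix.diagonal s := by
    rw [hTdef, Units.val_mul, Units.val_mul, hγA, ← Matrix.mul_assoc, ← Matrix.mul_assoc, Units.inv_mul, Matrix.one_mul, Matrix.mul_assoc, Units.inv_mul, Matrix.mul_one]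
  have hTs' : (T : Matrix (Fin 3) (Fin 3) K) = 1 + ϖ ^ N • Matrix.diagonal s' := by
    rw [hT, ← Matrix.diagonal_smul, ← Matrix.diagonal_one, Matrix.diagonal_add]
    congr 1
    funext i
    simp only [Pi.smul_apply, smul_eq_mul, hs'def]
    rw [mul_div_cancel₀ _ hc0]; ring
  -- the vertex in the eigenframe: `M = A⁻¹ · v`
  have hcunit : Valued.v (-(Matrix.diagonal d).det) = 1 := by
    rw [Valuation.map_neg, Matrix.det_diagonal, map_prod]
    exact Finset.prod_eq_one fun i _ => hd i
  have hM : IsSelfDualLattice σ ϖ (Matrix.diagonal d) (mapGL (A⁻¹ : GL (Fin 3) K) v.1) := by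
    rw [hdA, isSelfDualLattice_smul_formCongr_iff hcunit, ← mapGL_mul, mul_inv_cancel, mapGL_one]
    exact hv
  have hfix' : mapGL (γ : GL (Fin 3) K) v.1 = v.1 := (latticeGraphIso_eq_iff_mapGL_eq γ v).1 hfix
  have hfixM : mapGL T (mapGL (A⁻¹ : GL (Fin 3) K) v.1) = mapGL (A⁻¹ : GL (Fin 3) K) v.1 := by
    rw [hTdef, ← mapGL_mul, mul_assoc, mul_assoc, mul_inv_cancel, mul_one, mapGL_mul, hfix']
  have hlevM : (mapGL (A⁻¹ : GL (Fin 3) K) v.1).map ((Matrix.toLin' ((T : Matrix (Fin 3) (Fin 3) K) - 1)).restrictScalars 𝒪[K]) ≤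
      scaleLattice (ϖ ^ N) (mapGL (A⁻¹ : GL (Fin 3) K) v.1) := by
    have h := mapGL_map_conj_le_scaleLattice (A⁻¹ : GL (Fin 3) K) (((γ : GL (Fin 3) K) : Matrix (Fin 3) (Fin 3) K) - 1) (ϖ ^ N) hlev
    have hT1 : (T : Matrix (Fin 3) (Fin 3) K) - 1 =
        ((A⁻¹ : GL (Fin 3) K) : Matrix (Fin 3) (Fin 3) K) * (((γ : GL (Fin 3) K) : Matrix (Fin 3) (Fin 3) K) - 1) * (((A⁻¹)⁻¹ : GL (Fin 3) K) : Matrix (Fin 3) (Fin 3) K) := by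
      rw [inv_inv, hTdef, Units.val_mul, Units.val_mul, Matrix.mul_sub, Matrix.sub_mul, Matrix.mul_one, Units.inv_mul]
    rw [hT1]; exact h
  -- ★ the separable-stable root: `M = L₀`, hence `v = A·L₀ = L₀`
  have hML := eq_stdLattice_of_isSelfDualLattice_of_levelFixed_diagonal hvσ hϖ0 hϖ1 hd hs' hsep hc0 hc1 T hTs' hM hfixM hlevM
  have hAL : mapGL A (stdLattice K 3) = stdLattice K 3 := (mapGL_stdLattice_eq_iff A).2 ⟨hA, hA'⟩
  apply Subtype.ext
  change v.1 = stdLattice K 3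
  rw [← hAL, ← hML, ← mapGL_mul, mul_inv_cancel, mapGL_one]

open Classical in
/-- **L2 «ORIENTATION OF ROWS»** (junction skeleton v7 :493, binder order verbatim): for the junction's equilateral eigen-data and abstract labels `dep` (`hdep`,
`B = N`), every fixed self-dual `v ≠ r₀` has `dep v < N` and an inward neighbour `p` with a far vertex `g ≠ v` through `p` of level `ϖ^(dep v)`.
[cite: Kottwitz1986, §3] [cite: Serre1980Trees, I.2.3] [cite: Tits1979, §3.5] [cite: BruhatTits1972, §10] -/
theorem dep_lt_and_exists_orientation (hσ : ∀ x, σ (σ x) = x) (hvσ : ∀ a, Valued.v (σ a) = Valued.v a) (hσϖ : σ ϖ = -ϖ)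
    (hϖ : Valued.v ϖ = WithZero.exp (-1 : ℤ)) (hres : ∀ x : K, Valued.v x ≤ 1 → Valued.v (σ x - x) < 1) (h2 : Valued.v (2 : K) = 1) [Finite 𝓀[K]]
    (hT : (latticeGraph σ ϖ ((StdForm.antidiagonal 3).over K)).IsTree)
    {γ : unitaryGroupOfForm σ ((StdForm.antidiagonal 3).over K)} (hγ0 : γ ∈ unitaryInt σ ((StdForm.antidiagonal 3).over K))
    (hnorm : ∀ u : K, σ u = u → Valued.v (u - 1) < 1 → ∃ z : K, z * σ z = u ∧ Valued.v (z - 1) ≤ Valued.v (u - 1))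
    [ValuativeRel K] [(Valued.v : Valuation K ℤᵐ⁰).Compatible]
    (d : Fin 3 → K) (hd : ∀ i, Valued.v (d i) = 1) (_hdσ : ∀ i, σ (d i) = d i)
    (A : GL (Fin 3) K) (hA : IsIntMatrix (A : Matrix (Fin 3) (Fin 3) K)) (hA' : IsIntMatrix ((A⁻¹ : GL (Fin 3) K) : Matrix (Fin 3) (Fin 3) K))
    (hdA : Matrix.diagonal d = (-(Matrix.diagonal d).det) • formCongr σ A ((StdForm.antidiagonal 3).over K))
    (s : Fin 3 → K) (hs1 : s 1 = 1) (_hsv : ∀ i, Valued.v (s i) = 1) (_hsσ : ∀ i, s i * σ (s i) = 1)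
    (hγA : ((γ : GL (Fin 3) K) : Matrix (Fin 3) (Fin 3) K) = (A : Matrix (Fin 3) (Fin 3) K) * Matrix.diagonal s * ((A⁻¹ : GL (Fin 3) K) : Matrix (Fin 3) (Fin 3) K))
    {N : ℕ} (hN3 : 3 ≤ N) (hs0 : Valued.v (s 0 - 1) = Valued.v ϖ ^ N) (hs2 : Valued.v (s 2 - 1) = Valued.v ϖ ^ N) (hs02 : Valued.v (s 0 - s 2) = Valued.v ϖ ^ N)
    (c₁ ε : K) (_hc₁ : Valued.v c₁ = 1) (_hεv : Valued.v ε = 1) (_hε : ∀ z : K, Valued.v z ≤ 1 → Valued.v (z ^ 2 - ε) = 1)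
    (B : ℕ) (dep rk : {M : Submodule 𝒪[K] (Fin 3 → K) // IsVertex σ ϖ ((StdForm.antidiagonal 3).over K) M} → ℕ) (cl : {M : Submodule 𝒪[K] (Fin 3 → K) // IsVertex σ ϖ ((StdForm.antidiagonal 3).over K) M} → ℤ)
    (hdep : ∀ w : {M : Submodule 𝒪[K] (Fin 3 → K) // IsVertex σ ϖ ((StdForm.antidiagonal 3).over K) M}, latticeGraphIso σ ϖ ((StdForm.antidiagonal 3).over K) γ w = w → ∀ e, e ≤ dep w ↔ e ≤ B ∧ w.1.map ((Matrix.toLin' (((γ : GL (Fin 3) K) : Matrix (Fin 3) (Fin 3) K) - 1)).restrictScalars 𝒪[K]) ≤ scaleLattice (ϖ ^ e) w.1)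
    (_hrk : ∀ w : {M : Submodule 𝒪[K] (Fin 3 → K) // IsVertex σ ϖ ((StdForm.antidiagonal 3).over K) M}, rk w = if w.1.map ((Matrix.toLin' ((((γ : GL (Fin 3) K) : Matrix (Fin 3) (Fin 3) K) - 1) ^ 2)).restrictScalars 𝒪[K]) ≤ scaleLattice (ϖ ^ (2 * dep w + 1)) w.1 then 1 else 2)
    (_hcl : ∀ w : {M : Submodule 𝒪[K] (Fin 3 → K) // IsVertex σ ϖ ((StdForm.antidiagonal 3).over K) M}, cl w = if (∃ y ∈ w.1, ∃ a : K, Valued.v a = 1 ∧ Valued.v ((ϖ ^ (dep w))⁻¹ * pairing σ ((StdForm.antidiagonal 3).over K) y ((((γ : GL (Fin 3) K) : Matrix (Fin 3) (Fin 3) K) - 1) *ᵥ y) - (c₁) * a ^ 2) < 1) then (1 : ℤ) else -1)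
    (hBN : B = N)
    (v : {M : Submodule 𝒪[K] (Fin 3 → K) // IsVertex σ ϖ ((StdForm.antidiagonal 3).over K) M}) (hv : IsSelfDualLattice σ ϖ ((StdForm.antidiagonal 3).over K) v.1) (hvr : v ≠ ⟨stdLattice K 3, 0, isSelfDualLattice_stdLattice_three_of_v hϖ⟩) (hfix : latticeGraphIso σ ϖ ((StdForm.antidiagonal 3).over K) γ v = v) :
    dep v < N ∧ ∃ p g : {M : Submodule 𝒪[K] (Fin 3 → K) // IsVertex σ ϖ ((StdForm.antidiagonal 3).over K) M}, (latticeGraph σ ϖ ((StdForm.antidiagonal 3).over K)).Adj v p ∧ (latticeGraph σ ϖ ((StdForm.antidiagonal 3).over K)).dist ⟨stdLattice K 3, 0, isSelfDualLattice_stdLattice_three_of_v hϖ⟩ p + 1 = (latticeGraph σ ϖ ((StdForm.antidiagonal 3).over K)).dist ⟨stdLattice K 3, 0, isSelfDualLattice_stdLattice_three_of_v hϖ⟩ v ∧ (latticeGraph σ ϖ ((StdForm.antidiagonal 3).over K)).Adj p g ∧ g ≠ v ∧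
      g.1.map ((Matrix.toLin' (((γ : GL (Fin 3) K) : Matrix (Fin 3) (Fin 3) K) - 1)).restrictScalars 𝒪[K]) ≤ scaleLattice (ϖ ^ dep v) g.1 := by
  have hϖ1 : Valued.v ϖ ≤ 1 := by rw [hϖ, ← WithZero.exp_zero]; exact WithZero.exp_le_exp.2 (by norm_num)
  -- (1) `dep v < N`: otherwise `LEV[v](ϖ^N)` and `v` is the root
  have hlt : dep v < N := by
    by_contra hge
    have hN : N ≤ dep v := not_lt.1 hge
    have hlevN := ((hdep v hfix N).1 hN).2
    exact hvr (eq_root_of_isSelfDualLattice_of_lev_pow hvσ hϖ d hd A hA hA' hdA s hs1 hγA (by omega) hs0 hs2 hs02 hv hfix hlevN)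
  refine ⟨hlt, ?_⟩
  -- (2) the `∃`-clause: ★ `exists_parent_grandparent_lev_of_neg` at `e := dep v`
  obtain ⟨hdB, hlev⟩ := (hdep v hfix (dep v)).1 le_rfl
  have hpow : Valued.v ϖ ^ N ≤ Valued.v ϖ ^ dep v := pow_le_pow_right_of_le_one' hϖ1 (by omega)
  have hs1' : Valued.v (s 1 - 1) ≤ Valued.v ϖ ^ dep v := by rw [hs1, sub_self, map_zero]; exact zero_le
  have he : ∀ i, Valued.v (s i - 1) ≤ Valued.v ϖ ^ dep v := by
    intro i
    fin_cases i <;> simp only [Fin.zero_eta, Fin.mk_one, Fin.reduceFinMk]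
    exacts [hs0.le.trans hpow, hs1', hs2.le.trans hpow]
  exact exists_parent_grandparent_lev_of_neg hσ hvσ hσϖ hϖ hres h2 hnorm hT hγ0 A hA hA' s hγA he hv hvr hfix hlev

end Literature.NumberTheory.Automorphic.UnitaryLatticeTree

end
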